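import Summits.CriticalPhenomena.PercolationContinuityZ3.Theorems.Transplant.FluoriteLattice
import Summits.CriticalPhenomena.PercolationContinuityZ3.Theorems.Transplant.DiamondConnected
import Mathlib.Tactic.FinCases
import Mathlib.Tactic.Ring
import Mathlib.Tactic.Linarith
import HarnessLib

/-!
# The FLUORITE net, II: the skeleton cylinders about EVERY centre are connected (bcc descent at cations, tetrahedral descent at anions),
# hence (κ) at all three base vertices and connectedness of the fluorite net

builds on p205010 (kernel theorem, internal audit signed; external expert review pending) — nothing in this file uses p205010.
Status sentence (coordinator 2026-08-20T04:30Z): "θ(p_c) = 0 on ℤ^d, all d ≥ 2 — kernel-verified (Lean 4/Mathlib,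
standard axioms); internal adversarial audit SIGNED 2026-08-20 04:29Z; external expert review pending."

Lane `prim-bschramm-*`, seat `prim-bschramm-p2` (gen 6).  Input (κ) of `PlanarSkeletonConc` for the fluorite net of `FluoriteLattice.lean` is needed
at THREE inequivalent base vertices (a cation and one anion of each class), i.e. for cylinders `{w : fluSkel w − fluSkel c ∈ Λ_ℓ}` about centres
`c` that are NOT related by automorphisms.  We prove it about EVERY centre `c ∈ fluSite` by a descent on `|w − c|²` inside the cylinder
(`flu_descent`): at a CATION `w` all eight bonds `(±1,±1,±1)` are present and the bcc coordinatewise descent of `BccSkeletonConc`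
(`BccConc.descDir`) applies verbatim to `u = w − c`; at an ANION `w` the four bonds are tetrahedral and the diamond device of `DiamondConnected`
applies to `u = w − c`: the four inner products `⟨u, b⟩` sum to `0`, are pairwise congruent mod `4`, and their common residue is never `3`
(it is `1` for a cation centre and `0` or `2` for an anion centre — `tetra_min_gen`), so the least is `≤ −2`, and the least bond points towards the
cylinder axis.  Consequences: `fluCylAt_connected` (every centre, `ℓ ≥ 1`), `fluGraph_connected`.
[cite: ConwaySloane1999, Ch. 4 §7.1] [cite: KozmaNitzan2024, §4 p. 17 (sub-boxes / cylinders)]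
-/

noncomputable section

namespace Summit.CriticalPhenomena.PercolationContinuityZ3.Theorems.Transplant

open MeasureTheory Literature.Probability.Percolation Literature.Probability.LatticeModels SimpleGraph
open BccConc (normSq eq_zero_of_normSq_le_zero descDir descDir_unit normSq_add_descDir_lt)

/-! ## §1 Cylinders about an arbitrary centre -/

/-- The skeleton cylinder of half-width `ℓ` about the centre `c`: `{w : fluSkel w − fluSkel c ∈ Λ_ℓ}`. [cite: KozmaNitzan2024, §4 p. 25] -/
def fluCylAt (c : fluSite) (ℓ : ℕ) : Set fluSite := {w | fluSkel w - fluSkel c ∈ box 2 ℓ}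

/-- Membership in the cylinder, in skeleton coordinates. [folklore] -/
theorem mem_fluCylAt_iff {c : fluSite} {ℓ : ℕ} {w : fluSite} :
    w ∈ fluCylAt c ℓ ↔ (-(ℓ : ℤ) ≤ fluSkel w 0 - fluSkel c 0 ∧ fluSkel w 0 - fluSkel c 0 ≤ ℓ) ∧
      (-(ℓ : ℤ) ≤ fluSkel w 1 - fluSkel c 1 ∧ fluSkel w 1 - fluSkel c 1 ≤ ℓ) := by
  simp only [fluCylAt, Set.mem_setOf_eq, mem_box, Fin.forall_fin_two, Pi.sub_apply]

/-- The centre lies in its cylinders. [folklore] -/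
theorem centre_mem_fluCylAt (c : fluSite) (ℓ : ℕ) : c ∈ fluCylAt c ℓ := by
  rw [mem_fluCylAt_iff]; refine ⟨⟨?_, ?_⟩, ?_, ?_⟩ <;> simp

/-- The cylinder graph about `c`. [cite: KozmaNitzan2024, §4 p. 25] -/
abbrev fluCylGraph (c : fluSite) (ℓ : ℕ) : SimpleGraph (fluCylAt c ℓ) := fluGraph.induce (fluCylAt c ℓ)

/-- An all-odd point is a fluorite site (an anion). [folklore] -/
theorem mem_fluSite_of_odd {x : Site 3} (h0 : x 0 % 2 = 1) (h1 : x 1 % 2 = 1) (h2 : x 2 % 2 = 1) : x ∈ fluSite :=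
  ⟨by omega, by omega, Or.inl h2⟩

/-! ## §2 The general tetrahedral bound -/

/-- **The tetrahedral bound in general position**: the four integers `E, W, N, S` of the shape `±(u₀+u₁) + A`, `±(u₀−u₁) − A` with `A = ±u₂`
and `u₀ ≡ u₁ ≡ u₂ (mod 2)` sum to `0` and are congruent mod `4`; if their residue is not `3` and `u ≠ 0`, one of them is `≤ −2`. [folklore] -/
theorem tetra_min_gen (u0 u1 u2 A : ℤ) (hp0 : u0 % 2 = u2 % 2) (hp1 : u1 % 2 = u2 % 2) (hA : A = u2 ∨ A = -u2)
    (h3 : (u0 + u1 + A) % 4 ≠ 3) (hne : ¬ (u0 = 0 ∧ u1 = 0 ∧ u2 = 0)) :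
    (u0 + u1) + A ≤ -2 ∨ -(u0 + u1) + A ≤ -2 ∨ (u0 - u1) - A ≤ -2 ∨ -(u0 - u1) - A ≤ -2 := by
  rcases Int.emod_two_eq_zero_or_one u2 with h | h
  · obtain ⟨a, rfl⟩ : ∃ a, u0 = 2 * a := ⟨u0 / 2, by omega⟩
    obtain ⟨c, rfl⟩ : ∃ c, u1 = 2 * c := ⟨u1 / 2, by omega⟩
    obtain ⟨b, rfl⟩ : ∃ b, u2 = 2 * b := ⟨u2 / 2, by omega⟩
    rcases hA with rfl | rfl <;> omega
  · obtain ⟨a, rfl⟩ : ∃ a, u0 = 2 * a + 1 := ⟨u0 / 2, by omega⟩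
    obtain ⟨c, rfl⟩ : ∃ c, u1 = 2 * c + 1 := ⟨u1 / 2, by omega⟩
    obtain ⟨b, rfl⟩ : ∃ b, u2 = 2 * b + 1 := ⟨u2 / 2, by omega⟩
    rcases hA with rfl | rfl <;> omega

/-! ## §3 The descent -/

/-- The inner product with an east/west bond of the fluorite net. [folklore] -/
theorem ip_fluBondVec_zero (x : Site 3) (w : Site 3) (σ : ℤ) : ip x (fluBondVec w 0 σ) = σ * (x 0 + x 1) + fluFibre w 0 * x 2 := by
  unfold ip
  rw [fluBondVec_zero, fluBondVec_one, fluBondVec_two, if_pos rfl]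
  ring

/-- The inner product with a north/south bond of the fluorite net. [folklore] -/
theorem ip_fluBondVec_one (x : Site 3) (w : Site 3) (σ : ℤ) : ip x (fluBondVec w 1 σ) = σ * (x 0 - x 1) + fluFibre w 1 * x 2 := by
  unfold ip
  rw [fluBondVec_zero, fluBondVec_one, fluBondVec_two, if_neg (show (1 : Fin 2) ≠ 0 by decide)]
  ring

/-- At an anion the fibre components are `s` (east/west) and `−s` (north/south) with `s = 2 − (x₀+x₁+x₂ mod 4) = ±1`. [folklore] -/
theorem fluFibre_odd {w : Site 3} (hw : w 2 % 2 = 1) :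
    fluFibre w 0 = 2 - (w 0 + w 1 + w 2) % 4 ∧ fluFibre w 1 = -(2 - (w 0 + w 1 + w 2) % 4) := by
  unfold fluFibre
  have h : ¬ (w 2 % 2 = 0) := by omega
  rw [if_neg h, if_neg h, if_pos rfl, if_neg (show (1 : Fin 2) ≠ 0 by decide)]
  constructor <;> ring

/-- **DESCENT at a CATION**: all eight bonds are present, so the bcc coordinatewise descent on `u = w − c` applies. [folklore] -/
theorem flu_descent_cation {ℓ : ℕ} (hℓ : 1 ≤ ℓ) (c : fluSite) {w : fluSite} (hw : w ∈ fluCylAt c ℓ) (hne : (w : Site 3) ≠ c)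
    (hev : (w : Site 3) 2 % 2 = 0) :
    ∃ y : fluSite, ∃ hy : y ∈ fluCylAt c ℓ,
      (fluCylGraph c ℓ).Adj ⟨w, hw⟩ ⟨y, hy⟩ ∧ normSq ((y : Site 3) - c) < normSq ((w : Site 3) - c) := by
  obtain ⟨hw0, hw1, -⟩ := w.2
  have huw := two_mul_fluSkel_zero w
  have hvw := two_mul_fluSkel_one w
  have huc := two_mul_fluSkel_zero c
  have hvc := two_mul_fluSkel_one c
  have hbox := (mem_fluCylAt_iff).1 hw
  set u : Site 3 := (w : Site 3) - c with hu
  have hu0 : u 0 = (w : Site 3) 0 - (c : Site 3) 0 := rfl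
  have hu1 : u 1 = (w : Site 3) 1 - (c : Site 3) 1 := rfl
  have hub : u ∈ bccSite := bccSubgroup.sub_mem (fluSite_subset_bccSite w.2) (fluSite_subset_bccSite c.2)
  have hune : u ≠ 0 := fun h => hne (sub_eq_zero.1 h)
  set y : Site 3 := (w : Site 3) + descDir u with hy
  have hd := descDir_unit u
  have hymem : y ∈ fluSite := by
    apply mem_fluSite_of_odd
    · have := hd 0; simp only [hy, Pi.add_apply]; omega
    · have := hd 1; simp only [hy, Pi.add_apply]; omega
    · have := hd 2; simp only [hy, Pi.add_apply]; omega
  have hyu : y - c = u + descDir u := by rw [hy, hu]; abel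
  refine ⟨⟨y, hymem⟩, ?_, BccConc.bccGraph_adj_addUnit (toBccF w) hd, ?_⟩
  · rw [mem_fluCylAt_iff]
    have hy0 := two_mul_fluSkel_zero ⟨y, hymem⟩
    have hy1 := two_mul_fluSkel_one ⟨y, hymem⟩
    have ey0 : ((⟨y, hymem⟩ : fluSite) : Site 3) 0 = (w : Site 3) 0 + descDir u 0 := rfl
    have ey1 : ((⟨y, hymem⟩ : fluSite) : Site 3) 1 = (w : Site 3) 1 + descDir u 1 := rfl
    rw [ey0] at hy0 hy1; rw [ey1] at hy0 hy1
    unfold descDir at hy0 hy1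
    rw [hu0, hu1] at hy0 hy1
    split_ifs at hy0 hy1 <;> omega
  · show normSq (y - c) < normSq u
    rw [hyu]; exact normSq_add_descDir_lt hub hune

/-- **DESCENT at an ANION** (both classes at once, the class entering through the sign `s = ±1` of its fibre rule): the four tetrahedral
bonds; the tetrahedral device of `DiamondConnected` on `u = w − c` (the common residue of the four inner products is `1` for a cation centre and
`0` or `2` for an anion centre, never `3`). [cite: KozmaNitzan2024, §4 p. 17] -/
theorem flu_descent_anion {ℓ : ℕ} (hℓ : 1 ≤ ℓ) (c : fluSite) {w : fluSite} (hw : w ∈ fluCylAt c ℓ) (hne : (w : Site 3) ≠ c)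
    (hodd : (w : Site 3) 2 % 2 = 1) {s : ℤ} (hs : s = 1 ∨ s = -1) (hs1 : 2 - ((w : Site 3) 0 + (w : Site 3) 1 + (w : Site 3) 2) % 4 = s) :
    ∃ y : fluSite, ∃ hy : y ∈ fluCylAt c ℓ,
      (fluCylGraph c ℓ).Adj ⟨w, hw⟩ ⟨y, hy⟩ ∧ normSq ((y : Site 3) - c) < normSq ((w : Site 3) - c) := by
  -- the displacement `u = w − c` as an opaque vector with its three coordinates
  obtain ⟨u, hu⟩ : ∃ u : Site 3, (w : Site 3) - c = u := ⟨_, rfl⟩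
  have hu0 : u 0 = (w : Site 3) 0 - (c : Site 3) 0 := by rw [← hu]; rfl
  have hu1 : u 1 = (w : Site 3) 1 - (c : Site 3) 1 := by rw [← hu]; rfl
  have hu2 : u 2 = (w : Site 3) 2 - (c : Site 3) 2 := by rw [← hu]; rfl
  -- arithmetic of the classes (small context): parity of `u`, the residue of `u₀+u₁+s u₂`, `u ≠ 0`
  have hcls : u 0 % 2 = u 2 % 2 ∧ u 1 % 2 = u 2 % 2 ∧ (u 0 + u 1 + s * u 2) % 4 ≠ 3 := by
    obtain ⟨hw0, hw1, -⟩ := w.2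
    obtain ⟨hc0, hc1, hc2⟩ := c.2
    rcases hs with rfl | rfl <;> omega
  have hune : ¬ (u 0 = 0 ∧ u 1 = 0 ∧ u 2 = 0) := by
    intro h; apply hne; rw [← sub_eq_zero, hu]; ext j
    rcases (show j = 0 ∨ j = 1 ∨ j = 2 by fin_cases j <;> simp) with rfl | rfl | rfl
    · exact h.1
    · exact h.2.1
    · exact h.2.2
  obtain ⟨hp0, hp1, h3⟩ := hcls
  -- the tetrahedral bound with `A = s u₂`
  have hmin : (u 0 + u 1) + s * u 2 ≤ -2 ∨ -(u 0 + u 1) + s * u 2 ≤ -2 ∨ (u 0 - u 1) - s * u 2 ≤ -2 ∨ -(u 0 - u 1) - s * u 2 ≤ -2 := by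
    rcases hs with rfl | rfl
    · have h := tetra_min_gen (u 0) (u 1) (u 2) (u 2) hp0 hp1 (Or.inl rfl) (by rwa [one_mul] at h3) hune
      simpa only [one_mul] using h
    · have h := tetra_min_gen (u 0) (u 1) (u 2) (-u 2) hp0 hp1 (Or.inr rfl) (by rwa [neg_one_mul] at h3) hune
      simpa only [neg_one_mul, sub_neg_eq_add] using h
  clear hp0 hp1 h3 hune
  -- the fibre signs of the bonds at `w`
  obtain ⟨hf0, hf1⟩ := fluFibre_odd (w := (w : Site 3)) hodd
  rw [hs1] at hf0 hf1
  have vE : ip u (fluBondVec w 0 1) = (u 0 + u 1) + s * u 2 := by rw [ip_fluBondVec_zero, hf0]; ring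
  have vW : ip u (fluBondVec w 0 (-1)) = -(u 0 + u 1) + s * u 2 := by rw [ip_fluBondVec_zero, hf0]; ring
  have vN : ip u (fluBondVec w 1 1) = (u 0 - u 1) - s * u 2 := by rw [ip_fluBondVec_one, hf1]; ring
  have vS : ip u (fluBondVec w 1 (-1)) = -(u 0 - u 1) - s * u 2 := by rw [ip_fluBondVec_one, hf1]; ring
  clear hf0 hf1 hs1 hodd
  -- the skeleton bookkeeping
  have huw := two_mul_fluSkel_zero w
  have hvw := two_mul_fluSkel_one w
  have huc := two_mul_fluSkel_zero c
  have hvc := two_mul_fluSkel_one c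
  have hbox := (mem_fluCylAt_iff).1 hw
  -- the generic witness
  have build : ∀ (i : Fin 2) (σ : ℤ) (hσ : σ = 1 ∨ σ = -1),
      ((-(ℓ : ℤ) ≤ fluSkel w i + σ - fluSkel c i) ∧ fluSkel w i + σ - fluSkel c i ≤ ℓ) →
      2 * ip u (fluBondVec w i σ) + 3 < 0 →
      ∃ y : fluSite, ∃ hy : y ∈ fluCylAt c ℓ,
        (fluCylGraph c ℓ).Adj ⟨w, hw⟩ ⟨y, hy⟩ ∧ normSq ((y : Site 3) - c) < normSq ((w : Site 3) - c) := by
    intro i σ hσ hb hd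
    refine ⟨fluBondEnd w i hσ, ?_, fluGraph_adj_bondEnd w i hσ, ?_⟩
    · show fluSkel (fluBondEnd w i hσ) - fluSkel c ∈ box 2 ℓ
      rw [fluSkel_bondEnd, mem_box]
      intro j
      rw [Pi.sub_apply, Pi.add_apply]
      by_cases hj : j = i
      · subst hj; rw [Pi.single_eq_same]; exact hb
      · rw [Pi.single_eq_of_ne hj, add_zero]
        rcases (show j = 0 ∨ j = 1 by fin_cases j <;> simp) with rfl | rfl
        · exact hbox.1
        · exact hbox.2
    · have e : ((fluBondEnd w i hσ : fluSite) : Site 3) - c = u + fluBondVec w i σ := by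
        rw [coe_fluBondEnd, ← hu]; abel
      rw [hu, e, normSq_add_unit _ _ (fluBondVec_unit w w.2 i hσ)]
      linarith
  -- steering: the least of E/W (resp. N/S) points towards the axis; `A = s u₂` as one atom
  obtain ⟨A, hA⟩ : ∃ A : ℤ, s * u 2 = A := ⟨_, rfl⟩
  rw [hA] at hmin vE vW vN vS
  by_cases hu0' : fluSkel w 0 - fluSkel c 0 ≤ 0
  · by_cases hEv : 2 * ((u 0 + u 1) + A) + 3 < 0
    · exact build 0 1 (Or.inl rfl) (by omega) (by rw [vE]; exact hEv)
    · by_cases hv0' : fluSkel w 1 - fluSkel c 1 ≤ 0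
      · exact build 1 1 (Or.inl rfl) (by omega) (by rw [vN]; omega)
      · exact build 1 (-1) (Or.inr rfl) (by omega) (by rw [vS]; omega)
  · by_cases hWv : 2 * (-(u 0 + u 1) + A) + 3 < 0
    · exact build 0 (-1) (Or.inr rfl) (by omega) (by rw [vW]; exact hWv)
    · by_cases hv0' : fluSkel w 1 - fluSkel c 1 ≤ 0
      · exact build 1 1 (Or.inl rfl) (by omega) (by rw [vN]; omega)
      · exact build 1 (-1) (Or.inr rfl) (by omega) (by rw [vS]; omega)

/-- **DESCENT**: every vertex `w ≠ c` of the cylinder about `c` (`ℓ ≥ 1`) has a cylinder neighbour closer to `c` in `|·|²`.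
[cite: ConwaySloane1999, Ch. 4 §7.1] [cite: KozmaNitzan2024, §4 p. 17] -/
theorem flu_descent {ℓ : ℕ} (hℓ : 1 ≤ ℓ) (c : fluSite) {w : fluSite} (hw : w ∈ fluCylAt c ℓ) (hne : (w : Site 3) ≠ c) :
    ∃ y : fluSite, ∃ hy : y ∈ fluCylAt c ℓ,
      (fluCylGraph c ℓ).Adj ⟨w, hw⟩ ⟨y, hy⟩ ∧ normSq ((y : Site 3) - c) < normSq ((w : Site 3) - c) := by
  rcases Int.emod_two_eq_zero_or_one ((w : Site 3) 2) with hev | hodd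
  · exact flu_descent_cation hℓ c hw hne hev
  · have hs : (2 - ((w : Site 3) 0 + (w : Site 3) 1 + (w : Site 3) 2) % 4 = 1) ∨
        (2 - ((w : Site 3) 0 + (w : Site 3) 1 + (w : Site 3) 2) % 4 = -1) := by
      obtain ⟨hw0, hw1, -⟩ := w.2; omega
    rcases hs with h | h
    · exact flu_descent_anion hℓ c hw hne hodd (Or.inl rfl) h
    · exact flu_descent_anion hℓ c hw hne hodd (Or.inr rfl) h

/-! ## §4 Reachability, connected cylinders about every centre, connectedness -/

/-- **Every cylinder vertex is joined to the centre inside the cylinder** (`ℓ ≥ 1`; strong induction on `|w − c|²`). [folklore] -/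
theorem fluCylAt_reachable_centre {ℓ : ℕ} (hℓ : 1 ≤ ℓ) (c : fluSite) :
    ∀ (n : ℕ) (w : fluSite) (hw : w ∈ fluCylAt c ℓ), normSq ((w : Site 3) - c) ≤ n →
      (fluCylGraph c ℓ).Reachable ⟨w, hw⟩ ⟨c, centre_mem_fluCylAt c ℓ⟩ := by
  intro n
  induction n with
  | zero =>
    intro w hw hn
    have h0 : (w : Site 3) - c = 0 := eq_zero_of_normSq_le_zero (by exact_mod_cast hn)
    have : w = c := Subtype.ext (sub_eq_zero.1 h0)
    subst this
    rfl
  | succ n ih =>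
    intro w hw hn
    by_cases hwc : (w : Site 3) = c
    · have : w = c := Subtype.ext hwc
      subst this
      rfl
    · obtain ⟨y, hy, hadj, hlt⟩ := flu_descent hℓ c hw hwc
      have hyn : normSq ((y : Site 3) - c) ≤ n := by
        have : normSq ((y : Site 3) - c) < (n : ℤ) + 1 := lt_of_lt_of_le hlt (by exact_mod_cast hn)
        omega
      exact hadj.reachable.trans (ih y hy hyn)

/-- **(κ) for the fluorite net, about EVERY centre: the induced cylinder `{fluSkel w − fluSkel c ∈ Λ_ℓ}` is connected for `ℓ ≥ 1`.**
[cite: KozmaNitzan2024, §4 p. 17 (subboxes)] -/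
theorem fluCylAt_connected {ℓ : ℕ} (hℓ : 1 ≤ ℓ) (c : fluSite) : (fluCylGraph c ℓ).Connected := by
  haveI : Nonempty (fluCylAt c ℓ) := ⟨⟨c, centre_mem_fluCylAt c ℓ⟩⟩
  refine ⟨fun x y => ?_⟩
  have hx := fluCylAt_reachable_centre hℓ c (normSq ((x.1 : Site 3) - c)).toNat x.1 x.2 (Int.self_le_toNat _)
  have hy := fluCylAt_reachable_centre hℓ c (normSq ((y.1 : Site 3) - c)).toNat y.1 y.2 (Int.self_le_toNat _)
  exact hx.trans hy.symm

/-- Every fluorite site lies in the cylinder about the origin of half-width `|x₀| + |x₁| + 1`. [folklore] -/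
theorem mem_fluCylAt_origin (x : fluSite) : x ∈ fluCylAt fluOrigin (((x : Site 3) 0).natAbs + ((x : Site 3) 1).natAbs + 1) := by
  have hu := two_mul_fluSkel_zero x
  have hv := two_mul_fluSkel_one x
  have ha0 := le_abs_self ((x : Site 3) 0)
  have ha0' := neg_abs_le ((x : Site 3) 0)
  have ha1 := le_abs_self ((x : Site 3) 1)
  have ha1' := neg_abs_le ((x : Site 3) 1)
  rw [mem_fluCylAt_iff, fluSkel_origin]
  simp only [Pi.zero_apply, sub_zero]
  push_cast
  omega

/-- **The fluorite net is connected.** [cite: ConwaySloane1999, Ch. 4 §7.1] -/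
theorem fluGraph_connected : fluGraph.Connected := by
  haveI : Nonempty fluSite := ⟨fluOrigin⟩
  have key : ∀ x : fluSite, fluGraph.Reachable x fluOrigin := by
    intro x
    set ℓ : ℕ := ((x : Site 3) 0).natAbs + ((x : Site 3) 1).natAbs + 1 with hℓ
    have h1 : 1 ≤ ℓ := by rw [hℓ]; omega
    have h := fluCylAt_reachable_centre h1 fluOrigin (normSq ((x : Site 3) - (fluOrigin : fluSite))).toNat x (mem_fluCylAt_origin x)
      (Int.self_le_toNat _)
    exact h.map (Embedding.induce (fluCylAt fluOrigin ℓ)).toHom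
  exact ⟨fun x y => (key x).trans (key y).symm⟩

end Summit.CriticalPhenomena.PercolationContinuityZ3.Theorems.Transplant

end
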